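import Mathlib

/-!
# `SnSubsetDichotomy.ThresholdSubsetTriples` — stub `stub_cayleyDeletion` by explicit pivot recursion

Crux `stmt-MatrixMultiplication-10882`, registered stub `stub_cayleyDeletion`
(line `SketchIdeator2`), proved here by the **explicit greedy algorithm** (elementary route:
a structural recursion on the finite set `K`, no extremal / maximum-cardinality argument).

*Greedy independent set in a Cayley graph.*  Let `S ⊆ G` be finite with `1 ∈ S` and `S⁻¹ ⊆ S`.
For every finite `K ⊆ G` we construct `X ⊆ K` such that `x * x'⁻¹ ∈ S` forces `x = x'` for
`x, x' ∈ X`, with the **sharp** count `|K| ≤ |S| · |X|`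
(`PivotDeletion.exists_subset_quotient_avoiding_of_symm`), by strong induction on `K`
(`Finset.strongInduction`): if `K = ∅` take `X = ∅`; otherwise pick a pivot `x ∈ K`, delete the
right coset ball `S·x = {s * x | s ∈ S}` (which contains `x = 1 * x` and has `≤ |S|` points),
recurse on the survivor set `K' = {y ∈ K | y ∉ S·x} ⊊ K` to get `X' ⊆ K'`, and put
`X = insert x X'`.  A bad pair inside `insert x X'` must involve the pivot: `x * y'⁻¹ ∈ S` gives
`y' = (x y'⁻¹)⁻¹ * x ∈ S·x` (using `S⁻¹ ⊆ S`) and `y * x⁻¹ ∈ S` gives `y = (y x⁻¹) * x ∈ S·x`,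
both excluded for survivors; and `|K| = |K \ K'| + |K'| ≤ |S| + |S|·|X'| = |S|·|X|` as `x ∉ X'`.
The bound is attained when `K = S` is a subgroup.

The stub is the case `S = {1} ∪ B ∪ B⁻¹` of `G = Equiv.Perm (Fin n)`, where
`|S| ≤ 2|B| + 1` (`PivotDeletion.card_insert_one_union_image_inv_le`) and `B ⊆ S`.

Main declarations:
* `PivotDeletion.exists_subset_quotient_avoiding_of_symm` — greedy deletion for a symmetric
  unital `S`, with the sharp constant `|S|`;
* `PivotDeletion.card_insert_one_union_image_inv_le` — `|{1} ∪ B ∪ B⁻¹| ≤ 2|B| + 1`;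
* `stub_cayleyDeletion` — the registered stub, verbatim.
-/

namespace Summit.MatrixMultiplication.MatrixMultiplication.Theorems.ThresholdSubsetTriples.PivotRecursion

namespace PivotDeletion

variable {G : Type*} [Group G] [DecidableEq G]

/-- **Greedy Cayley deletion, sharp form.**  If `S ⊆ G` is finite, contains `1` and is closed
under inverses, then every finite `K ⊆ G` contains `X` with `x * x'⁻¹ ∈ S → x = x'` on `X` and
`K.card ≤ S.card * X.card`.  Explicit pivot recursion (`Finset.strongInduction`): delete the
right coset ball `S·x` of a pivot `x ∈ K`, recurse on the survivors, add the pivot.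
[folklore: greedy independent set in the Cayley graph `Cay(G, S)`, closed neighbourhoods `S·x`] -/
theorem exists_subset_quotient_avoiding_of_symm (S : Finset G) (h1 : (1 : G) ∈ S)
    (hinv : ∀ s ∈ S, s⁻¹ ∈ S) (K : Finset G) :
    ∃ X ⊆ K, (∀ x ∈ X, ∀ x' ∈ X, x * x'⁻¹ ∈ S → x = x') ∧ K.card ≤ S.card * X.card := by
  induction K using Finset.strongInduction with
  | H K ih =>
    rcases K.eq_empty_or_nonempty with rfl | ⟨x, hx⟩
    · exact ⟨∅, Finset.Subset.refl _, by simp, by simp⟩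
    · -- the pivot `x` lies in its own ball `S·x`, so the survivor set is a proper subset of `K`
      have hxN : x ∈ S.image (· * x) := Finset.mem_image.mpr ⟨1, h1, one_mul x⟩
      have hssub : K.filter (fun y => y ∉ S.image (· * x)) ⊂ K :=
        Finset.filter_ssubset.mpr ⟨x, hx, fun h => h hxN⟩
      -- recurse on the survivors
      obtain ⟨X', hX'sub, hX'ind, hX'card⟩ := ih _ hssub
      have hxX' : x ∉ X' := fun h => (Finset.mem_filter.mp (hX'sub h)).2 hxN
      refine ⟨insert x X', Finset.insert_subset hx (hX'sub.trans (Finset.filter_subset _ K)),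
        ?_, ?_⟩
      · -- admissibility of `insert x X'`: a bad pair must involve the pivot
        intro y hy y' hy' hyy'
        rw [Finset.mem_insert] at hy hy'
        rcases hy with rfl | hy
        · rcases hy' with rfl | hy'
          · rfl
          · -- `y * y'⁻¹ ∈ S` gives `y' = (y y'⁻¹)⁻¹ * y ∈ S·y`, but `y'` survived the pivot `y`
            exact absurd (Finset.mem_image.mpr ⟨(y * y'⁻¹)⁻¹, hinv _ hyy', by group⟩)
              (Finset.mem_filter.mp (hX'sub hy')).2
        · rcases hy' with rfl | hy'
          · -- `y * y'⁻¹ ∈ S` gives `y = (y y'⁻¹) * y' ∈ S·y'`, but `y` survived the pivot `y'`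
            exact absurd (Finset.mem_image.mpr ⟨y * y'⁻¹, hyy', by group⟩)
              (Finset.mem_filter.mp (hX'sub hy)).2
          · exact hX'ind y hy y' hy' hyy'
      · -- counting: `|K| = |K \ K'| + |K'| ≤ |S| + |S|·|X'| = |S|·|insert x X'|`
        have hdel : K \ K.filter (fun y => y ∉ S.image (· * x)) ⊆ S.image (· * x) := by
          intro y hy
          rw [Finset.mem_sdiff] at hy
          by_contra hyN
          exact hy.2 (Finset.mem_filter.mpr ⟨hy.1, hyN⟩)
        rw [Finset.card_insert_of_notMem hxX']
        calc K.card
            = (K \ K.filter (fun y => y ∉ S.image (· * x))).card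
                + (K.filter (fun y => y ∉ S.image (· * x))).card :=
              (Finset.card_sdiff_add_card_eq_card (Finset.filter_subset _ K)).symm
          _ ≤ S.card + S.card * X'.card :=
              Nat.add_le_add ((Finset.card_le_card hdel).trans Finset.card_image_le) hX'card
          _ = S.card * (X'.card + 1) := by ring

/-- The symmetric unital closure `{1} ∪ B ∪ B⁻¹` of a finite `B ⊆ G` has at most `2|B| + 1`
elements. -/
theorem card_insert_one_union_image_inv_le (B : Finset G) :
    (insert (1 : G) (B ∪ B.image (·⁻¹))).card ≤ 2 * B.card + 1 :=
  calc (insert (1 : G) (B ∪ B.image (·⁻¹))).card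
      ≤ (B ∪ B.image (·⁻¹)).card + 1 := Finset.card_insert_le _ _
    _ ≤ B.card + (B.image (·⁻¹)).card + 1 := Nat.add_le_add_right (Finset.card_union_le _ _) 1
    _ ≤ B.card + B.card + 1 :=
        Nat.add_le_add_right (Nat.add_le_add_left Finset.card_image_le _) 1
    _ = 2 * B.card + 1 := by ring

/-- `{1} ∪ B ∪ B⁻¹` is closed under inverses. -/
theorem inv_mem_insert_one_union_image_inv (B : Finset G) {s : G}
    (hs : s ∈ insert (1 : G) (B ∪ B.image (·⁻¹))) : s⁻¹ ∈ insert (1 : G) (B ∪ B.image (·⁻¹)) := by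
  rw [Finset.mem_insert, Finset.mem_union, Finset.mem_image] at hs ⊢
  rcases hs with rfl | hs | ⟨b, hb, rfl⟩
  · exact Or.inl inv_one
  · exact Or.inr (Or.inr ⟨s, hs, rfl⟩)
  · exact Or.inr (Or.inl (by rwa [inv_inv]))

end PivotDeletion

open PivotDeletion in
/-- **Stub `stub_cayleyDeletion` — Cayley-graph deletion, explicit greedy form** (line
`SketchIdeator2` of crux `SnSubsetDichotomy.ThresholdSubsetTriples`, stmt-MatrixMultiplication-10882).
For finite `K, B ⊆ S_n` there is `X ⊆ K` avoiding `B` as a right quotient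
(`x x'⁻¹ ∈ B ⇒ x = x'`) with `|K| ≤ (2|B| + 1)|X|`: apply the sharp pivot recursion
`PivotDeletion.exists_subset_quotient_avoiding_of_symm` to the symmetric unital set
`S = {1} ∪ B ∪ B⁻¹ ⊇ B`, whose size is at most `2|B| + 1`
(`PivotDeletion.card_insert_one_union_image_inv_le`). [folklore] -/
theorem stub_cayleyDeletion : ∀ (n : ℕ) (K B : Finset (Equiv.Perm (Fin n))), ∃ X ⊆ K, (∀ x ∈ X, ∀ x' ∈ X, x * x'⁻¹ ∈ B → x = x') ∧ K.card ≤ (2 * B.card + 1) * X.card := by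
  intro n K B
  obtain ⟨X, hXK, hXS, hcard⟩ :=
    exists_subset_quotient_avoiding_of_symm
      (insert (1 : Equiv.Perm (Fin n)) (B ∪ B.image (·⁻¹))) (Finset.mem_insert_self _ _)
      (fun _ hs => inv_mem_insert_one_union_image_inv B hs) K
  refine ⟨X, hXK, fun x hx x' hx' hB => hXS x hx x' hx' ?_, hcard.trans ?_⟩
  · -- `B ⊆ {1} ∪ B ∪ B⁻¹`
    exact Finset.mem_insert_of_mem (Finset.mem_union_left _ hB)
  · -- `|{1} ∪ B ∪ B⁻¹| · |X| ≤ (2|B| + 1) · |X|`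
    exact Nat.mul_le_mul_right _ (card_insert_one_union_image_inv_le B)

end Summit.MatrixMultiplication.MatrixMultiplication.Theorems.ThresholdSubsetTriples.PivotRecursion
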